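import Literature.AnabelianGeometry.SemiGraphs.WitnessIwahoriGroup
import Literature.Algebra.Module.PadicProductEndomorphisms
import Literature.AnabelianGeometry.EtaleTheta.AutOutDictionary
import Literature.AnabelianGeometry.SemiGraphs.ArithTotalEstrangementOpenKernelObstruction
import Literature.AnabelianGeometry.SemiGraphs.WitnessIwahoriCuspEdgeLike
import Mathlib.Tactic.LinearCombination
import HarnessLib

/-!
# The outer automorphism group of the Iwahori witness `P = ℤ_p ⋊ (1 + pℤ_p)` is FINITE — hence no outer
# action on `P` has a non-open kernel, and [SemiAnbd] Thm 5.4's `hest` cannot be designed on a chart with group `P`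

Mochizuki, *Semi-graphs of anabelioids*, Publ. RIMS **42** (2006), §5 Def. 5.3 (ii) p. 65 («totally arithmetically
estranged»), Thm. 5.4 p. 66, Ex. 5.6 p. 67 (in print the arithmetic action is through an INFINITE quotient of
`G_K` — Frobenius weights) [cite: MochizukiSemiAnbd2006, Def 5.3 (ii), p. 65]; §0 p. 5 (`Out`, `G ⋊^out J`).

PROOF-ONLY file (cell abc-iut, layer L3, T54 binder board, row «NV-hest-NONSPLIT» part 2 — the OBSTRUCTION half;
abc-iut-w6-d064).  Part 1 (`ArithTotalEstrangementAffineWitness.lean`, p440884) showed that Def. 5.3 (ii) is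
inhabited at an ABSTRACT decomposition datum in `Aff(ℤ_p)` with a faithful arithmetic action.  The natural
follow-up — realise such a design at `decompositionDataOfChart` of one of the tree's EXPLICIT tempered charts —
meets the obstruction isolated by abc-iut-w4-d040 (`ArithTotalEstrangementOpenKernelObstruction`: `hest` forces
the outer action `ρ : Π_A → Out(π₁^temp 𝒢)` to have NON-OPEN kernel).  The only explicit chart WITH an edge in the
tree has group `P = Iw p = ℤ_p ⋊ (1 + pℤ_p)` on the nose (abc-iut-f-177's `cuspChart p`); this file computes that
`Out(P)` is FINITE, so NO compact `Π_A` can act on `P` with closed non-open kernel: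

* `Iw.s_eq_zero_iff_forall_commute_conj` — the translation subgroup `N = {(a, 0)}` is CHARACTERISTIC: `x ∈ N` iff
  `x` commutes with all its conjugates;
* an additive self-map of `ℤ_p` is a scalar — the tree's `PadicProductEnd.addMonoidHom_apply_eq_mul`
  (`Literature/Algebra/Module/PadicProductEndomorphisms.lean`) BY NAME;
* `Iw.mulEquiv_apply_s` / `Iw.mulEquiv_apply_a` — **CLASSIFICATION of ALL (abstract) automorphisms of `P`**:
  `φ (a, s) = (λ a + κ s, s)` with `λ := φ(1,0).a` (a unit, `Iw.isUnit_mulEquiv_lambda`) and `κ := φ(0,1).a`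
  (the conjugation action pins the `s`-coordinate; 1-cocycles of the ABELIAN `U` in the torsion-free `ℤ_p` are
  `s ↦ κ s`);
* `Iw.inv_mul_mem_innerAut_iff` — `φ⁻¹ ψ` is INNER iff `λ_φ ≡ λ_ψ` and `κ_φ ≡ κ_ψ (mod p)` (inner automorphisms are
  exactly `λ ∈ 1 + pℤ_p`, `κ ∈ pℤ_p`); hence
* `Iw.finite_topOut` — **`Out_top(P)` is finite** (it injects into `𝔽_p × 𝔽_p`; in fact `|Out(P)| = p(p−1)` for odd
  `p`, not needed), `Iw.finiteIndex_ker_of_topOut` — every `ρ : Π_A →* Out_top(P)` has a kernel of finite index;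
* `not_isTotallyArithEstranged_of_continuousMulEquiv_iw` — consequently, for ANY semi-graph of anabelioids, ANY
  tempered chart `c` with `c.G ≃ₜ* P`, any COMPACT `Π_A` and any `ρ` with CLOSED kernel, `hest` FAILS at every vertex
  carrying two distinct abutting branches (w4-d040's `not_isTotallyArithEstranged_of_finiteIndex_ker` BY NAME).
  (At `cuspChart p` itself the cusp has ONE abutting branch, so Def. 5.3 (ii)'s first clause is vacuous there; the
  same finiteness feeds w4-d040's second-clause form `not_isArithEstrangedEdge_of_lt_of_isOpen_ker` with the
  element `ι(1, 0)` of `Π_v`, which does not commensurate the torus — v2 (append-only) section at the end: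
  `IwahoriWitness.not_isTotallyArithEstranged_cuspChart`, **`hest` fails at `cuspChart p` for every compact `Π_A`,
  every `ρ` with closed kernel, every choice of representatives**.)

Reading (no side taken): a chart-level non-split witness of `hest` needs a vertex group on which `Π_A` acts with
INFINITE outer image (the genuine situation of Ex. 5.6); a vertex group isomorphic to `P` cannot carry one.
No definition, no instance, no new named fact; classical group theory over Mathlib's `ℤ_[p]`; nothing here bears
on [IUTchIII] Cor. 3.12; typed ≠ proved.
-/

noncomputable section

namespace Literature.AnabelianGeometry.SemiGraphs

open Literature.AnabelianGeometry.EtaleTheta Topology IwahoriWitness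

variable {p : ℕ} [Fact p.Prime]

namespace Iw

/-! ### Translations, tori, conjugation -/

/-- Product of two translations. [cite: MochizukiSemiAnbd2006, §0 p.5] -/
theorem transl_mul_transl (a b : ℤ_[p]) : (⟨a, 0⟩ : Iw p) * ⟨b, 0⟩ = ⟨a + b, 0⟩ := by
  ext
  · rw [mul_a]; unfold w; ring
  · rw [mul_s]; ring

/-- `(a, s) = (a, 0) · (0, s)`. [cite: MochizukiSemiAnbd2006, §0 p.5] -/
theorem transl_mul_tor (a s : ℤ_[p]) : (⟨a, 0⟩ : Iw p) * ⟨0, s⟩ = ⟨a, s⟩ := by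
  ext
  · rw [mul_a]; ring
  · rw [mul_s]; ring

/-- `U` is commutative: `(0, s)(0, t) = (0, t)(0, s)`. [cite: MochizukiSemiAnbd2006, §0 p.5] -/
theorem tor_comm (s t : ℤ_[p]) : (⟨0, s⟩ : Iw p) * ⟨0, t⟩ = ⟨0, t⟩ * ⟨0, s⟩ := by
  ext
  · rw [mul_a, mul_a]; ring
  · rw [mul_s, mul_s]; ring

/-- Two translations commute. [cite: MochizukiSemiAnbd2006, §0 p.5] -/
theorem commute_of_s_eq_zero {x y : Iw p} (hx : x.s = 0) (hy : y.s = 0) : Commute x y := by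
  change x * y = y * x
  ext
  · rw [mul_a, mul_a, hx, hy]; unfold w; ring
  · rw [mul_s, mul_s, hx, hy]

/-- Conjugating the translation `(1, 0)` by `x` gives the translation `(1 + p x.s, 0)`.
[cite: MochizukiSemiAnbd2006, §0 p.5] -/
theorem conj_transl_one (x : Iw p) : x * ⟨1, 0⟩ * x⁻¹ = ⟨w p x.s, 0⟩ := by
  obtain ⟨hs, ha⟩ := conj_coords x ⟨1, 0⟩
  ext
  · rw [ha]; simp only [mul_zero, zero_mul, neg_zero, zero_add, mul_one]
  · rw [hs]

/-- **The translation subgroup is characteristic**: `x.s = 0` iff `x` commutes with every conjugate of itself.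
[cite: MochizukiSemiAnbd2006, §0 p.5] -/
theorem s_eq_zero_iff_forall_commute_conj (x : Iw p) :
    x.s = 0 ↔ ∀ y : Iw p, Commute x (y * x * y⁻¹) := by
  constructor
  · intro hx y
    exact commute_of_s_eq_zero hx (by rw [(conj_coords y x).1, hx])
  · intro h
    have hc := h ⟨1, 0⟩
    obtain ⟨hs, ha⟩ := conj_coords (⟨1, 0⟩ : Iw p) x
    have e := congrArg Iw.a hc.eq
    simp only [mul_a, ha, hs, w, mul_zero, add_zero, mul_one, one_mul] at e
    -- e : x.a + (1 + p x.s) (-(p x.s) + x.a) = (-(p x.s) + x.a) + (1 + p x.s) x.a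
    have h0 : ((p : ℤ_[p]) * x.s) * ((p : ℤ_[p]) * x.s) = 0 := by linear_combination -e
    rcases mul_eq_zero.mp (mul_self_eq_zero.mp h0) with h1 | h1
    · exact absurd h1 p_ne_zero
    · exact h1

/-! ### Classification of the automorphisms of `P` -/

/-- An automorphism of `P` preserves the translation subgroup: `(φ x).s = 0 ↔ x.s = 0`.
[cite: MochizukiSemiAnbd2006, §0 p.5] -/
theorem mulEquiv_s_eq_zero_iff (φ : Iw p ≃* Iw p) (x : Iw p) : (φ x).s = 0 ↔ x.s = 0 := by
  rw [s_eq_zero_iff_forall_commute_conj, s_eq_zero_iff_forall_commute_conj]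
  constructor
  · intro h y
    have := h (φ y)
    rw [← map_mul, ← map_inv, ← map_mul] at this
    -- Commute (φ x) (φ (y x y⁻¹)) ⇒ Commute x (y x y⁻¹)
    have e := this.eq
    rw [← map_mul, ← map_mul] at e
    exact φ.injective e
  · intro h z
    obtain ⟨y, rfl⟩ := φ.surjective z
    rw [← map_mul, ← map_inv, ← map_mul]
    exact (h y).map φ

/-- The `a`-coordinate of `φ` on translations is additive, hence SCALAR: `(φ (a, 0)).a = λ · a` with
`λ := (φ (1, 0)).a` (every additive self-map of `ℤ_p` is a scalar: the tree's
`PadicProductEnd.addMonoidHom_apply_eq_mul`). [cite: MochizukiSemiAnbd2006, §0 p.5] -/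
theorem mulEquiv_transl_a (φ : Iw p ≃* Iw p) (a : ℤ_[p]) : (φ ⟨a, 0⟩).a = (φ ⟨1, 0⟩).a * a := by
  -- the additive map `a ↦ (φ (a,0)).a`
  let f : ℤ_[p] →+ ℤ_[p] :=
    { toFun := fun a => (φ ⟨a, 0⟩).a
      map_zero' := by
        have : (⟨0, 0⟩ : Iw p) = 1 := rfl
        rw [this, map_one, one_a]
      map_add' := fun a b => by
        have hs : (φ ⟨a, 0⟩).s = 0 := (mulEquiv_s_eq_zero_iff φ _).mpr rfl
        rw [← transl_mul_transl, map_mul, mul_a, hs]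
        simp only [w, mul_zero, add_zero, one_mul] }
  have := Literature.Algebra.Module.PadicProductEnd.addMonoidHom_apply_eq_mul f a
  rw [mul_comm] at this
  exact this

/-- `λ := (φ (1, 0)).a` is non-zero. [cite: MochizukiSemiAnbd2006, §0 p.5] -/
theorem mulEquiv_lambda_ne_zero (φ : Iw p ≃* Iw p) : (φ ⟨1, 0⟩).a ≠ 0 := by
  intro h0
  have hs : (φ ⟨1, 0⟩).s = 0 := (mulEquiv_s_eq_zero_iff φ _).mpr rfl
  have h1 : φ ⟨1, 0⟩ = 1 := Iw.ext h0 hs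
  have h2 : (⟨1, 0⟩ : Iw p) = 1 := φ.injective (by rw [h1, map_one])
  exact one_ne_zero (congrArg Iw.a h2)

/-- **The `s`-coordinate is fixed**: `(φ x).s = x.s` for every automorphism `φ` of `P` (apply `φ` to
`(0,s)(1,0)(0,s)⁻¹ = (1 + p s, 0)`). [cite: MochizukiSemiAnbd2006, §0 p.5] -/
theorem mulEquiv_apply_s (φ : Iw p ≃* Iw p) (x : Iw p) : (φ x).s = x.s := by
  -- first for `x = (0, s)`
  have htor : ∀ s : ℤ_[p], (φ ⟨0, s⟩).s = s := by
    intro s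
    have hconj := conj_transl_one (⟨0, s⟩ : Iw p)
    have e := congrArg (fun z => (φ z).a) hconj
    simp only [map_mul, map_inv] at e
    rw [(conj_coords (φ ⟨0, s⟩) (φ ⟨1, 0⟩)).2, (mulEquiv_s_eq_zero_iff φ ⟨1, 0⟩).mpr rfl,
      mulEquiv_transl_a φ (w p s)] at e
    simp only [mul_zero, zero_mul, neg_zero, zero_add, w] at e
    -- e : (1 + p (φ(0,s)).s) λ = λ (1 + p s)
    have h0 : (((φ ⟨0, s⟩).s - s) * (p : ℤ_[p])) * (φ ⟨1, 0⟩).a = 0 := by linear_combination e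
    rcases mul_eq_zero.mp h0 with h1 | h1
    · rcases mul_eq_zero.mp h1 with h2 | h2
      · exact sub_eq_zero.mp h2
      · exact absurd h2 p_ne_zero
    · exact absurd h1 (mulEquiv_lambda_ne_zero φ)
  have hx : φ x = φ ⟨x.a, 0⟩ * φ ⟨0, x.s⟩ := by rw [← map_mul, transl_mul_tor]
  rw [hx, mul_s, (mulEquiv_s_eq_zero_iff φ _).mpr rfl, htor]
  ring

/-- The `a`-coordinates of `φ` on the torus `(0, s)` form a 1-cocycle of the ABELIAN group `U` with values in the
torsion-free `ℤ_p`, hence are LINEAR: `(φ (0, s)).a = κ · s` with `κ := (φ (0, 1)).a`.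
[cite: MochizukiSemiAnbd2006, §0 p.5] -/
theorem mulEquiv_tor_a (φ : Iw p ≃* Iw p) (s : ℤ_[p]) : (φ ⟨0, s⟩).a = (φ ⟨0, 1⟩).a * s := by
  have e := congrArg (fun z => (φ z).a) (tor_comm s (1 : ℤ_[p]))
  simp only [map_mul, mul_a, mulEquiv_apply_s] at e
  simp only [w] at e
  -- e : κ s + (1 + p s) κ 1 = κ 1 + (1 + p) κ s
  have h0 : ((φ ⟨0, s⟩).a - (φ ⟨0, 1⟩).a * s) * (p : ℤ_[p]) = 0 := by linear_combination -e
  rcases mul_eq_zero.mp h0 with h1 | h1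
  · exact sub_eq_zero.mp h1
  · exact absurd h1 p_ne_zero

/-- **CLASSIFICATION of the automorphisms of `P = ℤ_p ⋊ (1 + pℤ_p)`**: `(φ x).a = λ · x.a + κ · x.s` with
`λ = (φ (1,0)).a`, `κ = (φ (0,1)).a` (and `(φ x).s = x.s`, `mulEquiv_apply_s`).
[cite: MochizukiSemiAnbd2006, §0 p.5] -/
theorem mulEquiv_apply_a (φ : Iw p ≃* Iw p) (x : Iw p) :
    (φ x).a = (φ ⟨1, 0⟩).a * x.a + (φ ⟨0, 1⟩).a * x.s := by
  have hx : φ x = φ ⟨x.a, 0⟩ * φ ⟨0, x.s⟩ := by rw [← map_mul, transl_mul_tor]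
  rw [hx, mul_a, mulEquiv_apply_s, mulEquiv_transl_a, mulEquiv_tor_a]
  unfold w
  ring

/-- `λ = (φ (1,0)).a` is a UNIT (its inverse is the `λ` of `φ⁻¹`). [cite: MochizukiSemiAnbd2006, §0 p.5] -/
theorem isUnit_mulEquiv_lambda (φ : Iw p ≃* Iw p) : IsUnit (φ ⟨1, 0⟩).a := by
  have e := mulEquiv_apply_a φ (φ.symm ⟨1, 0⟩)
  rw [MulEquiv.apply_symm_apply, mulEquiv_apply_s φ.symm] at e
  simp only [mul_zero, add_zero] at e
  exact isUnit_iff_exists_inv.mpr ⟨_, e.symm⟩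

/-- The coordinates of an INNER automorphism: `λ = 1 + p g.s`, `κ = −p g.a`.
[cite: MochizukiSemiAnbd2006, §0 p.5] -/
theorem conj_lambda_kappa (g : Iw p) :
    ((MulAut.conj g) ⟨1, 0⟩).a = w p g.s ∧ ((MulAut.conj g) ⟨0, 1⟩).a = -((p : ℤ_[p]) * g.a) := by
  refine ⟨?_, ?_⟩
  · rw [MulAut.conj_apply, (conj_coords g ⟨1, 0⟩).2]
    simp only [mul_zero, zero_mul, neg_zero, zero_add, mul_one]
  · rw [MulAut.conj_apply, (conj_coords g ⟨0, 1⟩).2]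
    simp only [mul_one, mul_zero, add_zero]

/-! ### Inner automorphisms and the invariants `λ mod p`, `κ mod p` -/

/-- `p · z` reduces to `0` modulo `p`. [cite: MochizukiSemiAnbd2006, §0 p.5] -/
theorem toZMod_p_mul (z : ℤ_[p]) : PadicInt.toZMod ((p : ℤ_[p]) * z) = 0 := by
  rw [← RingHom.mem_ker, PadicInt.ker_toZMod, PadicInt.maximalIdeal_eq_span_p]
  exact Ideal.mul_mem_right _ _ (Ideal.mem_span_singleton_self _)

/-- Elements with the same reduction modulo `p` differ by a multiple of `p`. [cite: MochizukiSemiAnbd2006, §0 p.5] -/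
theorem exists_eq_add_p_mul_of_toZMod_eq {x y : ℤ_[p]} (h : PadicInt.toZMod x = PadicInt.toZMod y) :
    ∃ t : ℤ_[p], y = x + (p : ℤ_[p]) * t := by
  have hmem : y - x ∈ Ideal.span {(p : ℤ_[p])} := by
    rw [← PadicInt.maximalIdeal_eq_span_p, ← PadicInt.ker_toZMod, RingHom.mem_ker, map_sub, h, sub_self]
  obtain ⟨t, ht⟩ := Ideal.mem_span_singleton'.mp hmem
  exact ⟨t, by linear_combination -ht⟩

/-- **`φ⁻¹ ψ` is inner iff `λ_φ ≡ λ_ψ` and `κ_φ ≡ κ_ψ (mod p)`.** [cite: MochizukiSemiAnbd2006, §0 p.5] -/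
theorem inv_mul_mem_innerAut_iff (φ ψ : MulAut (Iw p)) :
    φ⁻¹ * ψ ∈ innerAut (Iw p) ↔
      PadicInt.toZMod (φ ⟨1, 0⟩).a = PadicInt.toZMod (ψ ⟨1, 0⟩).a ∧
        PadicInt.toZMod (φ ⟨0, 1⟩).a = PadicInt.toZMod (ψ ⟨0, 1⟩).a := by
  constructor
  · rintro ⟨g, hg⟩
    have hψ : ψ = φ * MulAut.conj g := by rw [hg, mul_inv_cancel_left]
    have key : ∀ x : Iw p, (ψ x).a = (φ ⟨1, 0⟩).a * (-((p : ℤ_[p]) * x.s * g.a) + w p g.s * x.a) +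
        (φ ⟨0, 1⟩).a * x.s := by
      intro x
      rw [hψ, MulAut.mul_apply, mulEquiv_apply_a φ, MulAut.conj_apply, (conj_coords g x).1, (conj_coords g x).2]
    refine ⟨?_, ?_⟩
    · rw [key]
      simp only [mul_zero, zero_mul, neg_zero, zero_add, add_zero, w]
      rw [show (φ ⟨1, 0⟩).a * ((1 + (p : ℤ_[p]) * g.s) * 1) =
          (φ ⟨1, 0⟩).a + (p : ℤ_[p]) * (g.s * (φ ⟨1, 0⟩).a) by ring, map_add, toZMod_p_mul, add_zero]
    · rw [key]
      simp only [mul_one, mul_zero, add_zero]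
      rw [show (φ ⟨1, 0⟩).a * -((p : ℤ_[p]) * g.a) + (φ ⟨0, 1⟩).a =
          (φ ⟨0, 1⟩).a + (p : ℤ_[p]) * (-(g.a * (φ ⟨1, 0⟩).a)) by ring, map_add, toZMod_p_mul, add_zero]
  · rintro ⟨hl, hk⟩
    obtain ⟨t₀, ht₀⟩ := exists_eq_add_p_mul_of_toZMod_eq hl
    obtain ⟨b₀, hb₀⟩ := exists_eq_add_p_mul_of_toZMod_eq hk
    obtain ⟨μ, hμ⟩ := (isUnit_mulEquiv_lambda φ).exists_left_inv
    -- the conjugator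
    refine ⟨⟨-(b₀ * μ), t₀ * μ⟩, ?_⟩
    rw [eq_inv_mul_iff_mul_eq]
    ext x
    · rw [MulAut.mul_apply, mulEquiv_apply_a φ, mulEquiv_apply_a ψ, MulAut.conj_apply,
        (conj_coords _ x).1, (conj_coords _ x).2, ht₀, hb₀]
      simp only [w]
      linear_combination ((p : ℤ_[p]) * x.s * b₀ + (p : ℤ_[p]) * t₀ * x.a) * hμ
    · rw [MulAut.mul_apply, mulEquiv_apply_s φ, mulEquiv_apply_s ψ, MulAut.conj_apply, (conj_coords _ x).1]

/-! ### `Out_top(P)` is finite -/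

/-- **`Out_top(P)` is FINITE**: `(λ mod p, κ mod p)` is a well-defined injection
`Out_top(P) = Aut_top(P)/Inn(P) ↪ 𝔽_p × 𝔽_p`. [cite: MochizukiSemiAnbd2006, §0 p.5] -/
theorem finite_topOut (p : ℕ) [Fact p.Prime] : Finite (TopOut (Iw p)) := by
  classical
  let inv : contMulAut (Iw p) → ZMod p × ZMod p := fun φ =>
    (PadicInt.toZMod ((φ : MulAut (Iw p)) ⟨1, 0⟩).a, PadicInt.toZMod ((φ : MulAut (Iw p)) ⟨0, 1⟩).a)
  have hcompat : ∀ φ ψ : contMulAut (Iw p), (QuotientGroup.leftRel (innerContAut (Iw p))) φ ψ → inv φ = inv ψ := by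
    intro φ ψ h
    rw [QuotientGroup.leftRel_apply, Subgroup.mem_subgroupOf] at h
    have h' : ((φ : MulAut (Iw p)))⁻¹ * (ψ : MulAut (Iw p)) ∈ innerAut (Iw p) := by
      simpa only [Subgroup.coe_mul, Subgroup.coe_inv] using h
    obtain ⟨hl, hk⟩ := (inv_mul_mem_innerAut_iff _ _).mp h'
    exact Prod.ext hl hk
  let F : TopOut (Iw p) → ZMod p × ZMod p := Quotient.lift inv hcompat
  refine Finite.of_injective F ?_
  intro q₁ q₂ hq
  induction q₁ using QuotientGroup.induction_on with
  | H φ =>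
    induction q₂ using QuotientGroup.induction_on with
    | H ψ =>
      change inv φ = inv ψ at hq
      rw [QuotientGroup.eq, Subgroup.mem_subgroupOf, Subgroup.coe_mul, Subgroup.coe_inv]
      exact (inv_mul_mem_innerAut_iff _ _).mpr ⟨congrArg Prod.fst hq, congrArg Prod.snd hq⟩

/-- Hence every homomorphism `ρ : Π_A → Out_top(P)` has a kernel of FINITE INDEX.
[cite: MochizukiSemiAnbd2006, §0 p.5] -/
theorem finiteIndex_ker_of_topOut {PA : Type*} [Group PA] (ρ : PA →* TopOut (Iw p)) : ρ.ker.FiniteIndex := by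
  haveI := finite_topOut p
  refine ⟨?_⟩
  rw [Subgroup.index_ker]
  exact Nat.card_pos.ne'

end Iw

namespace IwahoriWitness

/-! ### No chart with group `≅ P` carries a totally arithmetically estranged design (compact `Π_A`, closed kernel) -/

/-- **At any tempered chart whose group is (bi-continuously) isomorphic to `P = ℤ_p ⋊ (1 + pℤ_p)`, `hest` FAILS**
for every COMPACT `Π_A`, every outer action `ρ` with CLOSED kernel, every choice of representatives, at every
vertex carrying two distinct branches: `Out_top(P)` is finite, so `ker ρ` has finite index and is open, and
abc-iut-w4-d040's open-kernel obstruction applies. [cite: MochizukiSemiAnbd2006, Thm 5.4, p. 66] -/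
theorem not_isTotallyArithEstranged_of_continuousMulEquiv_iw {𝒢 : ProfiniteSemiGraph.{0}}
    (c : ProfiniteSemiGraph.TemperedPiChart 𝒢) (e : c.G ≃ₜ* Iw p)
    {PA : Type} [Group PA] [TopologicalSpace PA] [IsTopologicalGroup PA] [CompactSpace PA]
    (ρ : PA →* TopOut c.G) (hcl : IsClosed (ρ.ker : Set PA)) (R : ProfiniteSemiGraph.ChartRepresentatives c)
    {v : 𝒢.graph.Vertex} {b b' : 𝒢.graph.Branch} (hbb' : b' ≠ b) (hb : 𝒢.graph.abuts b = some v)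
    (hb' : 𝒢.graph.abuts b' = some v) :
    ¬ IsTotallyArithEstranged
        (ProfiniteSemiGraph.decompositionDataOfChart R (toOuterSemidirectProduct ρ))
        (outerSemidirectProductSnd ρ) := by
  have hker : ((TopOut.transportEquiv e).toMonoidHom.comp ρ).ker = ρ.ker := by
    rw [← MonoidHom.comap_ker, (MonoidHom.ker_eq_bot_iff _).mpr (by exact (TopOut.transportEquiv e).injective),
      MonoidHom.comap_bot]
  have hfin : ρ.ker.FiniteIndex := hker ▸ Iw.finiteIndex_ker_of_topOut _
  exact ProfiniteSemiGraph.not_isTotallyArithEstranged_of_finiteIndex_ker c ρ hfin hcl R hbb' hb hb'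

end IwahoriWitness


namespace IwahoriWitness

open ProfiniteSemiGraph

/-! ### v2 (append-only): the single-branch cusp of `cuspChart p` — Def. 5.3 (ii)'s SECOND clause also fails -/

/-- `P` is centre-free. [cite: MochizukiSemiAnbd2006, Def 2.4(ii) p.25] -/
theorem center_iw_eq_bot : Subgroup.center (Iw p) = ⊥ := by
  rw [← Subgroup.centralizer_univ, ← Subgroup.coe_top]
  exact Iw.centralizer_eq_bot_of_isOpen ⊤ isOpen_univ

/-- A conjugate of the torus `T_0` is the torus `T_{−p g.a}`. [cite: MochizukiSemiAnbd2006, Def 2.4(iv) p.26] -/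
theorem map_conj_range_bHom_zero (g : Iw p) :
    ((Iw.bHom (p := p) 0).toMonoidHom.range).map (MulAut.conj g).toMonoidHom =
      (Iw.bHom (-((p : ℤ_[p]) * g.a))).toMonoidHom.range := by
  ext z
  constructor
  · rintro ⟨y, hy, rfl⟩
    have h := Iw.conj_mem_range_bHom 0 g y hy
    rw [MulEquiv.coe_toMonoidHom, MulAut.conj_apply]
    simpa only [mul_zero, zero_sub] using h
  · intro hz
    refine ⟨g⁻¹ * z * g⁻¹⁻¹, ?_, by rw [MulEquiv.coe_toMonoidHom, MulAut.conj_apply]; group⟩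
    have h := Iw.conj_mem_range_bHom (-((p : ℤ_[p]) * g.a)) g⁻¹ z hz
    have hc : w p g⁻¹.s * -((p : ℤ_[p]) * g.a) - (p : ℤ_[p]) * g⁻¹.a = 0 := by
      rw [Iw.inv_s, Iw.inv_a]
      have hw := winv_mul_w p g.s
      unfold w at hw ⊢
      linear_combination ((p : ℤ_[p]) * g.a) * hw
    rwa [hc] at h

/-- The translation `(1, 0)` does NOT commensurate a torus `T_c`: `(1,0) T_c (1,0)⁻¹ = T_{c − p}` meets `T_c`
trivially and `T_c` is infinite. [cite: MochizukiSemiAnbd2006, Def 2.4(iv) p.26] -/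
theorem relIndex_map_conj_transl_range_bHom (c : ℤ_[p]) :
    (((Iw.bHom (p := p) c).toMonoidHom.range).map (MulAut.conj (⟨1, 0⟩ : Iw p)).toMonoidHom).relIndex
      (Iw.bHom (p := p) c).toMonoidHom.range = 0 := by
  refine Iw.relIndex_eq_zero_of_inf_eq_bot c ?_
  rw [eq_bot_iff]
  rintro z ⟨hz, ⟨y, hy, rfl⟩⟩
  rw [Subgroup.mem_bot]
  have h := Iw.conj_mem_range_bHom c ⟨1, 0⟩ y hy
  rw [MulEquiv.coe_toMonoidHom, MulAut.conj_apply] at hz ⊢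
  have hne : c ≠ w p (0 : ℤ_[p]) * c - (p : ℤ_[p]) * 1 := by
    unfold w
    intro h0
    apply Iw.p_ne_zero (p := p)
    linear_combination h0
  exact Iw.eq_one_of_mem_range_bHom_of_mem hne hz h

/-- **At the explicit chart `cuspChart p` of the one-vertex-one-cusp semi-graph of anabelioids (`π₁^temp = P` on the
nose) `hest` FAILS for every COMPACT `Π_A`, every outer action `ρ` with CLOSED kernel and every choice of
representatives** — via Def. 5.3 (ii)'s SECOND clause at the cusp's single abutting branch: `Out_top(P)` is finite,
so `ker ρ` is open (finite index, closed, compact), and the element `ι(1, 0)` of `Π_v` lies outside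
`Π_b = Π_v ∩ Comm(ι T)` (a translation does not commensurate a torus; `ι` is injective as `P` is centre-free), so
abc-iut-w4-d040's `not_isArithEstrangedEdge_of_lt_of_isOpen_ker` applies. [cite: MochizukiSemiAnbd2006, Thm 5.4, p. 66] -/
theorem not_isTotallyArithEstranged_cuspChart {PA : Type} [Group PA] [TopologicalSpace PA] [IsTopologicalGroup PA]
    [CompactSpace PA] (ρ : PA →* TopOut (cuspChart p).G) (hcl : IsClosed (ρ.ker : Set PA))
    (R : ChartRepresentatives (cuspChart p)) :
    ¬ IsTotallyArithEstranged (decompositionDataOfChart R (toOuterSemidirectProduct ρ))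
        (outerSemidirectProductSnd ρ) := by
  intro hest
  haveI hfin : ρ.ker.FiniteIndex := Iw.finiteIndex_ker_of_topOut (p := p) ρ
  have hopen : IsOpen (ρ.ker : Set PA) := Subgroup.isOpen_of_isClosed_of_finiteIndex ρ.ker hcl
  have hb : (cuspGraph p).graph.abuts true = some PUnit.unit := rfl
  -- the representatives: `Π^temp_{𝔾,v} = P`, `Π^temp_{𝔾,b} = g₀ T_0 g₀⁻¹ = T_{c₀}`
  have hHv : R.Hv PUnit.unit = ⊤ := by
    have h := R.Hv_mem PUnit.unit
    rw [verticialSubgroups_cuspChart_eq] at h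
    exact h
  obtain ⟨g₀, hg₀⟩ : ∃ g₀ : Iw p,
      R.Hb true = ((Iw.bHom (p := p) 0).toMonoidHom.range).map (MulAut.conj g₀).toMonoidHom := by
    have h := R.Hb_mem true
    rw [edgeLikeSubgroups_cuspChart_eq] at h
    exact h
  rw [map_conj_range_bHom_zero] at hg₀
  set c₀ : ℤ_[p] := -((p : ℤ_[p]) * g₀.a) with hc₀
  -- the element `ι(1,0)`
  set ι := toOuterSemidirectProduct ρ with hι
  have hιinj : Function.Injective ι := toOuterSemidirectProduct_injective ρ (center_iw_eq_bot (p := p))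
  have hgv : ι ⟨1, 0⟩ ∈ arithVertGp R ι PUnit.unit :=
    map_le_arithVertGp R ι PUnit.unit ⟨⟨1, 0⟩, by rw [hHv]; exact Subgroup.mem_top _, rfl⟩
  have hgb : ι ⟨1, 0⟩ ∉ arithBrGp R ι true := by
    rw [arithBrGp_of_abuts R ι hb, Subgroup.mem_inf, not_and]
    intro _ hmem
    rw [Subgroup.Commensurable.commensurator_mem_iff] at hmem
    change Subgroup.Commensurable (conjSubgroup (ι ⟨1, 0⟩) ((R.Hb true).map ι)) ((R.Hb true).map ι) at hmem
    rw [conjSubgroup_map_toOuterSemidirectProduct, hg₀] at hmem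
    have h1 := hmem.1
    rw [Subgroup.relIndex_map_map_of_injective _ _ hιinj] at h1
    exact h1 (relIndex_map_conj_transl_range_bHom (p := p) c₀)
  exact not_isArithEstrangedEdge_of_lt_of_isOpen_ker (cuspChart p) ρ hopen R hb hgv hgb (hest _)

end IwahoriWitness

end Literature.AnabelianGeometry.SemiGraphs

end
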